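import Literature.AlgebraicGeometry.Resolution.HasseSchmidtLinearPartCriterion
import Literature.AlgebraicGeometry.Resolution.SmoothStalkOrderCriterion
import HarnessLib

/-!
# The LINEAR-PART criterion at closed points of schemes smooth over a perfect field: `Diff^{≤ N}(h) ⊄ 𝔪_ξ²` when
# `ord_ξ h = N + 1` and `p ∤ N + 1`

Topic: `Literature/AlgebraicGeometry/Resolution`. Sequel of `SmoothPointOrderCriterion.lean` / `SmoothStalkOrderCriterion.lean` (the UNIT
form: at a closed point of a smooth `K`-scheme, `K` perfect, an element of `𝔪_ξ`-adic order exactly `N` is taken to a unit by a differential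
operator of order `≤ N`) with the abstract input `HasseSchmidtLinearPartCriterion.exists_hsComponent_adicOrder_eq_one`: in the TAME case
`p ∤ ord_ξ h` (`p` the characteristic of `K`, prime or `0`) some differential operator of order `≤ ord_ξ h − 1` takes `h` to an element of
`𝔪_ξ`-adic order EXACTLY `1` — a «hypersurface of order one through the point» inside `Diff^{≤ ord h − 1}((h))`, which therefore is NOT
contained in `𝔪_ξ²`. (In the WILD case `p ∣ ord_ξ h` this may fail: `h = y^p + x^{p+1}`.)

* `exists_isDiffOpLE_adicOrder_eq_one_of_etaleCoordinates`, `not_diffIdeal_le_sq_of_etaleCoordinates` — ring level: `K` perfect of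
  characteristic `p`, `A` of finite type over `K` and formally étale over `K[X_σ]`, `𝔭` maximal, `O = A_𝔭` (same construction of the
  Hasse–Schmidt homomorphism and of the adapted generators `π_i(x_i)/π_i′(x_i)` as in `SmoothPointOrderCriterion`);
* `exists_isDiffOpLE_adicOrder_eq_one_stalk_of_smooth`, `not_diffIdeal_stalk_le_sq_of_smooth` — scheme level: `f : Z → Spec K` smooth,
  `K` perfect, `ξ ∈ Z` closed (standard-smooth affine chart, étale over affine space, as in `SmoothStalkOrderCriterion`).

Consumer (index only; nothing about that manuscript is asserted here): the Hironaka-2017 adjudication cell (`res-hironaka`), GAP row R96 /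
Tier-B item E9 — no «LL-head desert» in the tame regime `p ∤ b̂`.
Sources: [EGAIV4] §16.8, Thm. 16.11.2, §17.6; [Matsumura1987] §27; [VillamayorU2008ReesDiff] §4.1, Remark 4.3.
-/

noncomputable section

namespace Literature.AlgebraicGeometry.Resolution

open IsLocalRing MvPowerSeries CategoryTheory TopologicalSpace _root_.AlgebraicGeometry

universe u v w

/-! ## Ring level: algebras étale over affine space -/

section Ring

variable (K : Type u) [Field K] {σ : Type v} [Fintype σ] [DecidableEq σ]
  {A : Type w} [CommRing A] [Algebra K A] [Algebra (MvPolynomial σ K) A] [IsScalarTower K (MvPolynomial σ K) A]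

omit [Fintype σ] in
/-- The linear coefficient of `C a + t_i` is `δ_ij`. [folklore] -/
private theorem coeff_single_C_add_X' (a : A) (i j : σ) :
    coeff (Finsupp.single j 1) (MvPowerSeries.C a + MvPowerSeries.X i : MvPowerSeries σ A) =
      if i = j then 1 else 0 := by
  rw [map_add, MvPowerSeries.coeff_C, MvPowerSeries.coeff_X, if_neg (Finsupp.single_ne_zero.mpr one_ne_zero)]
  simp only [zero_add, Finsupp.single_left_inj one_ne_zero, eq_comm]

/-- The residue field of a local algebra over a field of characteristic `p` has characteristic `p` (bookkeeping). [folklore] -/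
private theorem charP_residueField_of_algebra (p : ℕ) [CharP K p] (O : Type*) [CommRing O] [IsLocalRing O] [Algebra K O] :
    CharP (ResidueField O) p :=
  charP_of_injective_ringHom (((residue O).comp (algebraMap K O)).injective) p

/-- **Linear-part form of the order criterion at a closed point of an algebra étale over affine space (TAME case).** Let `K` be a
PERFECT field of characteristic `p` (prime or `0`), `A` a `K`-algebra of finite type, formally smooth and formally unramified over `K[X_σ]`,
`𝔭 ⊂ A` maximal, `O = A_𝔭` with its `K`-structure. If `h ∈ 𝔪_O^{N+1} ∖ 𝔪_O^{N+2}` and `p ∤ N + 1`, then some `K`-linear differential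
operator `D` of `O` of order `≤ N` (`IsDiffOpLE`) has `ord_𝔪 (D h) = 1` EXACTLY. Construction of the Hasse–Schmidt homomorphism and of
the adapted generators as in `exists_isDiffOpLE_isUnit_pow_of_etaleCoordinates`; conclusion by
`exists_hsComponent_adicOrder_eq_one`. [cite: VillamayorU2008ReesDiff, §4.1 and Remark 4.3] [cite: EGAIV4, §16.8, Thm. 16.11.2 and §17.6] -/
theorem exists_isDiffOpLE_adicOrder_eq_one_of_etaleCoordinates [PerfectField K] (p : ℕ) [CharP K p]
    [Algebra.FormallySmooth (MvPolynomial σ K) A] [Algebra.FormallyUnramified (MvPolynomial σ K) A]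
    [Algebra.FiniteType K A] (𝔭 : Ideal A) [𝔭.IsMaximal] (O : Type*) [CommRing O] [IsLocalRing O] [Algebra A O]
    [IsLocalization.AtPrime O 𝔭] [Algebra K O] [IsScalarTower K A O] {N : ℕ} {h : O}
    (h1 : h ∈ maximalIdeal O ^ (N + 1)) (h2 : h ∉ maximalIdeal O ^ (N + 2)) (hp : ¬ p ∣ N + 1) :
    ∃ D : O →ₗ[K] O, IsDiffOpLE K N D ∧ adicOrder (D h) = 1 := by
  haveI : CharP (ResidueField O) p := charP_residueField_of_algebra K p O
  -- the coordinates `x_i ∈ A`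
  set x : σ → A := fun i => algebraMap (MvPolynomial σ K) A (MvPolynomial.X i) with hx
  -- (1) Hasse–Schmidt homomorphism on `A` extending the Taylor shift, and on `O`
  obtain ⟨TA, hTA0, hTAR⟩ := exists_hasseSchmidt_of_formallySmooth K A (σ := σ)
  have hTAK : ∀ c : K, TA (algebraMap K A c) = MvPowerSeries.C (algebraMap K A c) := by
    intro c
    have hc : algebraMap K A c = algebraMap (MvPolynomial σ K) A (MvPolynomial.C c) := by
      rw [← MvPolynomial.algebraMap_eq, ← IsScalarTower.algebraMap_apply]
    conv_lhs => rw [hc, hTAR, MvPolynomial.eval₂_C]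
    rfl
  have hTAx : ∀ i, TA (x i) = MvPowerSeries.C (x i) + MvPowerSeries.X i := by
    intro i
    rw [hx]
    simp only [hTAR, MvPolynomial.eval₂_X]
  obtain ⟨T, hT0, hTK, hTA⟩ := exists_hasseSchmidt_localization TA O 𝔭.primeCompl hTA0 hTAK
  have hTcomp : ∀ (β : σ →₀ ℕ) (a : A),
      hsComponent T β (algebraMap A O a) = algebraMap A O (hsComponent TA β a) := by
    intro β a
    simp only [hsComponent, hTA, MvPowerSeries.coeff_map]
  -- (2) the residue field and the separable minimal polynomials of the coordinates of the point
  letI := Ideal.Quotient.field 𝔭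
  haveI : Algebra.FiniteType K (A ⧸ 𝔭) :=
    Algebra.FiniteType.of_surjective (Ideal.Quotient.mkₐ K 𝔭) (Ideal.Quotient.mkₐ_surjective K 𝔭)
  haveI : Module.Finite K (A ⧸ 𝔭) := finite_of_finite_type_of_isJacobsonRing K (A ⧸ 𝔭)
  set a : σ → A ⧸ 𝔭 := fun i => Ideal.Quotient.mk 𝔭 (x i) with ha
  have hint : ∀ i, IsIntegral K (a i) := fun i => Algebra.IsIntegral.isIntegral (a i)
  set π : σ → Polynomial K := fun i => minpoly K (a i) with hπ
  have hπsep : ∀ i, (π i).Separable := fun i =>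
    PerfectField.separable_of_irreducible (minpoly.irreducible (hint i))
  have hπ𝔭 : ∀ i, Polynomial.aeval (x i) (π i) ∈ 𝔭 := by
    intro i
    rw [← Ideal.Quotient.eq_zero_iff_mem, ← Ideal.Quotient.algebraMap_eq, ← Polynomial.aeval_algebraMap_apply,
      Ideal.Quotient.algebraMap_eq]
    exact minpoly.aeval K (a i)
  have hπ'𝔭 : ∀ i, Polynomial.aeval (x i) (Polynomial.derivative (π i)) ∉ 𝔭 := by
    intro i hmem
    apply (hπsep i).aeval_derivative_ne_zero (minpoly.aeval K (a i))
    rw [ha]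
    simp only
    rw [← Ideal.Quotient.algebraMap_eq, Polynomial.aeval_algebraMap_apply, Ideal.Quotient.algebraMap_eq,
      Ideal.Quotient.eq_zero_iff_mem]
    exact hmem
  -- (3) the maximal ideal of `O` is generated by the `w_i = π_i(x_i)`
  have hmax := maximalIdeal_eq_span_aeval_of_formallyUnramified K 𝔭 O π hπsep hπ𝔭
  set w : σ → O := fun i => algebraMap A O (Polynomial.aeval (x i) (π i)) with hw
  have hmax' : maximalIdeal O = Ideal.span (Set.range w) := hmax
  have hw𝔪 : ∀ i, w i ∈ maximalIdeal O := fun i => hmax' ▸ Ideal.subset_span ⟨i, rfl⟩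
  have hv : ∀ i, IsUnit (algebraMap A O (Polynomial.aeval (x i) (Polynomial.derivative (π i)))) := fun i =>
    IsLocalization.map_units O (⟨_, hπ'𝔭 i⟩ : 𝔭.primeCompl)
  set u : σ → O := fun i => w i * ↑(hv i).unit⁻¹ with hu
  have hspan : Ideal.span (Set.range u) = maximalIdeal O := by
    rw [hmax']
    apply le_antisymm
    · rw [Ideal.span_le]
      rintro _ ⟨i, rfl⟩
      exact Ideal.mul_mem_right _ _ (Ideal.subset_span ⟨i, rfl⟩)
    · rw [Ideal.span_le]
      rintro _ ⟨i, rfl⟩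
      have : w i = u i * ↑(hv i).unit := by
        rw [hu]
        simp only
        rw [mul_assoc, Units.inv_mul, mul_one]
      rw [SetLike.mem_coe, this]
      exact Ideal.mul_mem_right _ _ (Ideal.subset_span ⟨i, rfl⟩)
  -- first-order adaptation `D^{[e_j]} u_i ≡ δ_ij (mod 𝔪)`
  have hDw : ∀ i j, hsComponent T (Finsupp.single j 1) (w i) =
      algebraMap A O (Polynomial.aeval (x i) (Polynomial.derivative (π i))) * (if i = j then 1 else 0) := by
    intro i j
    rw [hw]
    simp only
    rw [hTcomp, hsComponent_single_aeval TA hTA0 hTAK, map_mul]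
    congr 1
    rw [hsComponent, hTAx, coeff_single_C_add_X']
    split_ifs <;> simp
  have hlin : ∀ i j, hsComponent T (Finsupp.single j 1) (u i) - (if i = j then 1 else 0) ∈ maximalIdeal O := by
    intro i j
    rw [hu]
    simp only
    rw [hsComponent_single_mul T hT0, hDw]
    have hrest : w i * hsComponent T (Finsupp.single j 1) ↑(hv i).unit⁻¹ ∈ maximalIdeal O :=
      Ideal.mul_mem_right _ _ (hw𝔪 i)
    have hvv : algebraMap A O (Polynomial.aeval (x i) (Polynomial.derivative (π i))) * ↑(hv i).unit⁻¹ = 1 :=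
      (hv i).mul_val_inv
    split_ifs with hij
    · rw [mul_one, hvv, add_sub_cancel_left]
      exact hrest
    · rw [mul_zero, zero_mul, zero_add, sub_zero]
      exact hrest
  -- (4) conclude by the abstract linear-part criterion
  obtain ⟨β, hβ, hord⟩ := exists_hsComponent_adicOrder_eq_one T p hT0 hspan hlin h1 h2 hp
  exact ⟨hsComponentₗ T hTK β, hβ ▸ isDiffOpLE_hsComponentₗ T hTK hT0 (Finsupp.degree β) β le_rfl, hord⟩

/-- **`Diff^{≤ N}_{O/K}((h)) ⊄ 𝔪_O²`** for `h` of `𝔪_O`-adic order exactly `N + 1` with `p ∤ N + 1`, in the setting of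
`exists_isDiffOpLE_adicOrder_eq_one_of_etaleCoordinates` (the tree's `diffIdeal`). [cite: VillamayorU2008ReesDiff, §4.1 and Remark 4.3] -/
theorem not_diffIdeal_le_sq_of_etaleCoordinates [PerfectField K] (p : ℕ) [CharP K p]
    [Algebra.FormallySmooth (MvPolynomial σ K) A] [Algebra.FormallyUnramified (MvPolynomial σ K) A]
    [Algebra.FiniteType K A] (𝔭 : Ideal A) [𝔭.IsMaximal] (O : Type*) [CommRing O] [IsLocalRing O] [Algebra A O]
    [IsLocalization.AtPrime O 𝔭] [Algebra K O] [IsScalarTower K A O] {N : ℕ} {h : O}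
    (h1 : h ∈ maximalIdeal O ^ (N + 1)) (h2 : h ∉ maximalIdeal O ^ (N + 2)) (hp : ¬ p ∣ N + 1) :
    ¬ diffIdeal K N (Ideal.span {h}) ≤ maximalIdeal O ^ 2 := by
  obtain ⟨D, hD, hord⟩ := exists_isDiffOpLE_adicOrder_eq_one_of_etaleCoordinates K (σ := σ) p 𝔭 O h1 h2 hp
  intro hle
  exact ((adicOrder_eq_one_iff _).mp hord).2 (hle (apply_mem_diffIdeal K hD (Ideal.mem_span_singleton_self _)))

end Ring

/-! ## Scheme level: closed points of schemes smooth over a perfect field -/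

section Scheme

variable {K : Type u} [Field K] {Z : Scheme.{u}} (f : Z ⟶ Spec (.of K))

/-- **Linear-part form of the order criterion at a closed point of a smooth scheme over a perfect field (TAME case).** For
`f : Z → Spec K` smooth, `K` perfect of characteristic `p` (prime or `0`), `ξ ∈ Z` closed, `h ∈ 𝔪_ξ^{N+1} ∖ 𝔪_ξ^{N+2}` and `p ∤ N + 1`: some
`K`-linear differential operator of `𝒪_{Z,ξ}` of order `≤ N` takes `h` to an element of `𝔪_ξ`-adic order exactly `1` (the `K`-structure being
`K → Γ(Z,𝒪_Z) → 𝒪_{Z,ξ}`, `Resolution.stalkAlgebra`). Chart as in `exists_isDiffOpLE_isUnit_pow_stalk_of_smooth`.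
[cite: VillamayorU2008ReesDiff, §4.1 and Remark 4.3] [cite: EGAIV4, §16.8, Thm. 16.11.2 and §17] -/
theorem exists_isDiffOpLE_adicOrder_eq_one_stalk_of_smooth [PerfectField K] (p : ℕ) [CharP K p] [Smooth f] (ξ : Z)
    (hξ : IsClosed ({ξ} : Set Z)) {N : ℕ} {h : Z.presheaf.stalk ξ}
    (h1 : h ∈ maximalIdeal (Z.presheaf.stalk ξ) ^ (N + 1)) (h2 : h ∉ maximalIdeal (Z.presheaf.stalk ξ) ^ (N + 2))
    (hp : ¬ p ∣ N + 1) :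
    letI := stalkAlgebra (f.appTop.hom.comp (Scheme.ΓSpecIso (.of K)).inv.hom) ξ
    ∃ D : Z.presheaf.stalk ξ →ₗ[K] Z.presheaf.stalk ξ, IsDiffOpLE K N D ∧ adicOrder (D h) = 1 := by
  set φ₀ : K →+* Γ(Z, ⊤) := f.appTop.hom.comp (Scheme.ΓSpecIso (.of K)).inv.hom with hφ₀
  letI := stalkAlgebra φ₀ ξ
  -- a standard smooth affine chart at `ξ`
  have hx : ξ ∈ f.smoothLocus := by
    rw [Scheme.Hom.smoothLocus_eq_top]
    trivial
  obtain ⟨d, ⟨U, hU⟩, ⟨V, hV⟩, hξV, e', hstd⟩ :=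
    Literature.AlgebraicGeometry.Motives.exists_appLE_isStandardSmoothOfRelativeDimension_of_mem_smoothLocus f hx
  have hUtop : U = ⊤ := by
    ext y
    simp only [Opens.coe_top, Set.mem_univ, iff_true]
    have : f ξ ∈ U := e' hξV
    rwa [Subsingleton.elim y (f ξ)]
  subst hUtop
  have hφ : sectionsHom φ₀ V =
      (f.appLE ⊤ V e').hom.comp (Scheme.ΓSpecIso (.of K)).commRingCatIsoToRingEquiv.symm.toRingHom := rfl
  have hφstd : (sectionsHom φ₀ V).IsStandardSmoothOfRelativeDimension d := by
    rw [hφ]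
    exact RingHom.isStandardSmoothOfRelativeDimension_respectsIso.2 _ _ hstd
  obtain ⟨g, hgC, hgEt⟩ := RingHom.IsStandardSmoothOfRelativeDimension.exists_etale_mvPolynomial hφstd
  letI : Algebra K Γ(Z, V) := sectionsAlgebra φ₀ V
  letI : Algebra (MvPolynomial (Fin d) K) Γ(Z, V) := g.toAlgebra
  haveI : IsScalarTower K (MvPolynomial (Fin d) K) Γ(Z, V) :=
    IsScalarTower.of_algebraMap_eq (R := K) (S := MvPolynomial (Fin d) K) (A := Γ(Z, V)) fun c => by
      show sectionsHom φ₀ V c = g (algebraMap K (MvPolynomial (Fin d) K) c)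
      rw [MvPolynomial.algebraMap_eq, ← hgC]
      rfl
  haveI : Algebra.Etale (MvPolynomial (Fin d) K) Γ(Z, V) := hgEt
  haveI : Algebra.FormallyEtale (MvPolynomial (Fin d) K) Γ(Z, V) := Algebra.Etale.formallyEtale
  haveI : Algebra.FinitePresentation (MvPolynomial (Fin d) K) Γ(Z, V) := Algebra.Etale.finitePresentation
  haveI : Algebra.FiniteType K Γ(Z, V) :=
    Algebra.FiniteType.trans (S := MvPolynomial (Fin d) K) inferInstance inferInstance
  letI : Algebra Γ(Z, V) (Z.presheaf.stalk ξ) := TopCat.Presheaf.algebra_section_stalk Z.presheaf ⟨ξ, hξV⟩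
  haveI : IsLocalization.AtPrime (Z.presheaf.stalk ξ) (hV.primeIdealOf ⟨ξ, hξV⟩).asIdeal :=
    hV.isLocalization_stalk ⟨ξ, hξV⟩
  haveI : (hV.primeIdealOf ⟨ξ, hξV⟩).asIdeal.IsMaximal := hV.primeIdealOf_isMaximal_of_isClosed ⟨ξ, hξV⟩ hξ
  haveI : IsScalarTower K Γ(Z, V) (Z.presheaf.stalk ξ) :=
    IsScalarTower.of_algebraMap_eq (R := K) (S := Γ(Z, V)) (A := Z.presheaf.stalk ξ) fun c => by
      show stalkHom φ₀ ξ c = (Z.presheaf.germ V ξ hξV).hom (sectionsHom φ₀ V c)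
      rw [← germ_comp_sectionsHom φ₀ V ξ hξV]
      rfl
  exact exists_isDiffOpLE_adicOrder_eq_one_of_etaleCoordinates K (σ := Fin d) p (hV.primeIdealOf ⟨ξ, hξV⟩).asIdeal
    (Z.presheaf.stalk ξ) h1 h2 hp

/-- **Ideal form (TAME case): `Diff^{≤ N}(J)_ξ ⊄ 𝔪_ξ²` whenever `J ⊆ 𝔪_ξ^{N+1}`, `J ⊄ 𝔪_ξ^{N+2}` and `p ∤ N + 1`** at a closed point `ξ` of a
smooth scheme over a perfect field `K` of characteristic `p` (the tree's `diffIdeal` for the `K`-structure `K → Γ(Z,𝒪_Z) → 𝒪_{Z,ξ}`):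
pick `h ∈ J ∖ 𝔪_ξ^{N+2}` and the operator of `exists_isDiffOpLE_adicOrder_eq_one_stalk_of_smooth`. Companion of
`diffIdeal_stalk_eq_top_iff_not_le_pow_of_smooth` one order lower. [cite: VillamayorU2008ReesDiff, §4.1 and Remark 4.3]
[cite: EGAIV4, §16.8 and Thm. 16.11.2] -/
theorem not_diffIdeal_stalk_le_sq_of_smooth [PerfectField K] (p : ℕ) [CharP K p] [Smooth f] (ξ : Z)
    (hξ : IsClosed ({ξ} : Set Z)) (N : ℕ) (J : Ideal (Z.presheaf.stalk ξ))
    (h1 : J ≤ maximalIdeal (Z.presheaf.stalk ξ) ^ (N + 1)) (h2 : ¬ J ≤ maximalIdeal (Z.presheaf.stalk ξ) ^ (N + 2))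
    (hp : ¬ p ∣ N + 1) :
    letI := stalkAlgebra (f.appTop.hom.comp (Scheme.ΓSpecIso (.of K)).inv.hom) ξ
    ¬ diffIdeal K N J ≤ maximalIdeal (Z.presheaf.stalk ξ) ^ 2 := by
  letI := stalkAlgebra (f.appTop.hom.comp (Scheme.ΓSpecIso (.of K)).inv.hom) ξ
  obtain ⟨h, hJ, hh⟩ := Set.not_subset.mp h2
  obtain ⟨D, hD, hord⟩ := exists_isDiffOpLE_adicOrder_eq_one_stalk_of_smooth f p ξ hξ (h1 hJ) hh hp
  intro hle
  exact ((adicOrder_eq_one_iff _).mp hord).2 (hle (apply_mem_diffIdeal K hD hJ))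

end Scheme

end Literature.AlgebraicGeometry.Resolution

end
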